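import Mathlib
import Literature.MathematicalPhysics.QuantumFieldTheory.Balaban1983to89.B5Hk165L2Zd

/-!
# [B5] p.29 / (1.103) p.34 — the scalar operator `H_k` is bounded `ℓ²(ℤ^d) → ℓ²_η` UNIFORMLY IN THE MESH

[B5] = T. Bałaban, *Propagators and renormalization transformations for lattice gauge theories. I*, Commun.
Math. Phys. **95** (1984) 17–40 [`Balaban1984PropagatorsI`].  PRINTED TEXT (TEXT LOCATIONS ONLY — nothing printed
enters as a hypothesis; quotations checked against the page renders read as images): p. 29 [PDF 13], after (1.67):
«We will need also a representation of H_k similar to the representation (1.44) of the projection R. It will be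
expressed in terms of well-defined bounded operators. We are going to define them now.»; p. 34 [PDF 18]:
«H_kB = GQ*(QGQ*)⁻¹B.» (1.103) and «This representation allows us to reduce a proof of properties of H_k to the
corresponding properties of G.»

WHAT THIS FILE PROVES (scalar analogue on the whole lattice `ℤ^d`, in the tree's un-rescaled block convention:
coarse sites `y ∈ ℤ^d`, fine sites `p ∈ ℤ^d` grouped in the blocks `B n y` of `(n+1)^d` sites, `η = (n+1)⁻¹`; the
scalar kernel `H(p,y) = kerH n a p y` of `B5Hk103ScalarZd` is exactly the scalar `GQ'*(Q'G'Q'*)⁻¹` of (1.103), and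
`HBZd n a B p = Σ'_y B(y)H(p,y)` is the operator of `B5Hk165L2Zd` on square-summable coarse data).  The predecessor
leaf `B5Hk165L2Zd` (p191559) proved that `H` maps `ℓ²(ℤ^d)` into the square-summable fine fields with an operator
bound whose constant grows like `(n+1)^{2d}` (plain Schur test on the pointwise kernel bound), and recorded this as
an honest-scope caveat.  Here the bound is made UNIFORM IN THE MESH in the natural `η`-weighted norm
`‖A‖²_η = η^d Σ_p A(p)²` of the fine lattice:

  `tsum_HBZd_sq_le_uniform`:  `(n+1)^{−d} Σ'_p (H B)(p)² ≤ (c_H(d,a)·K_d(δ_H(d,a)))² · Σ'_y B(y)²`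

for every `n`, every `a > 0` and every square-summable `B`, with the tree's constants `c_H, δ_H` of the kernel
decay (`B5Hk103ScalarZd.abs_kerH_le`, `kerH_blockRMS_le`) and the lattice constant `K_d(b) ≥ Σ_y e^{−b|x−y|_∞}`
(`B4Sect5Proof.latticeConst`) — all depending on `d, a` only.  Route: (§1) Minkowski's inequality for a series
of vectors on a finite window, `Σ_{p∈S}(Σ'_y g_y(p))² ≤ (Σ'_y ‖g_y‖_{ℓ²(S)})²`, proved by duality from the finite
Cauchy–Schwarz inequality; (§2) the block norms `‖H(·,y)‖_{ℓ²(B(y″))} ≤ c_H (n+1)^{d/2} e^{−δ_H|y″−y|_∞}` — the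
tree's mesh-free block-RMS decay `kerH_blockRMS_le`, which is where the factor `(n+1)^{d/2}` (instead of the
pointwise `(n+1)^{d/2}` on EACH of the `(n+1)^d` sites of a block) is won; (§3) the block estimate
`Σ_{p∈B(y″)} (H B)(p)² ≤ (Σ'_y ‖H(·,y)‖_{ℓ²(B(y″))}|B(y)|)²`; (§4) the `tsum` Schur test of `B5Hk165L2Zd` for the
coarse kernel `M(y″,y) = ‖H(·,y)‖_{ℓ²(B(y″))}` (row and column sums `≤ c_H (n+1)^{d/2} K_d(δ_H)`) and summation
block by block (`tsum_blocks`); (§5) the same bound for the finitely supported `HB n a T B` of `B5Hk103Minimizer`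
and the `η`-normalised form of (1.65), `η^{d−2}⟨∂(H B), ∂(H B)⟩ = ⟨B, Δ^{scalar}B⟩ ≤ (π²/4)^{d+1}⟨∂₁B, ∂₁B⟩`, so that
BOTH `‖H_kB‖_η` and `‖∂^ηH_kB‖_η` are bounded by mesh-independent multiples of `‖B‖_{ℓ²}`, `‖∂₁B‖_{ℓ²}`.

HONEST SCOPE.  (i) Scalar analogue only (no vector indices, no axial-gauge constraint `R∂* = 0`), whole lattice
`ℤ^d` (no torus), as in the whole scalar-`ℤ^d` column of this package.  (ii) The constant `(c_H K_d(δ_H))²` is the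
tree's, not optimised; no claim is made about the printed constants.  (iii) The finite bilinear version with
off-diagonal decay is already the tree's `B5Hk103ScalarZd.abs_sum_sum_kerH_le`; the new content here is the
operator statement on ALL of `ℓ²(ℤ^d)` (infinite sums on both sides) with the mesh-uniform constant, closing
the caveat «The `ℓ²` operator bound of §2 is qualitative (its constant grows with the mesh); no mesh-uniform norm is
claimed» of the HONEST SCOPE of `B5Hk165L2Zd`.  (iv) `ℓ²` data only: coarse fields of finite energy that are not
square-summable are not treated (same scope as `B5Ineq167L2Zd`, `B5Hk165L2Zd`).  NOT summit progress:
infrastructure for the scalar model of [B5] §1 only.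

ABSOLUTE-RULE CENSUS: hypotheses of the theorems below are `0 < a`, `Summable fun x => B x ^ 2` (resp. `B = 0`
off a finite `T` in `tsum_HB_sq_le_uniform`) only; no `Prop`-valued printed statement, no internally minted fact.
Citations: [Balaban1984PropagatorsI] p. 29, (1.65) p. 29, (1.103) p. 34 — text locations; everything else
[folklore].  Unit `b2b-balaban-pv23-g10` (SURGE NODE PROVER #23 gen 10, scalar whole-lattice `ℤ^d` column,
self-row B5-HK-UNIFORM-L2-ZD); staged byte-identically under `HOME/lean/BalabanYm4/`.
-/

namespace Literature.MathematicalPhysics.QuantumFieldTheory.Balaban1983to89.B5HkUniformL2Zd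

open Filter Topology
open B6QGQLower276 (X B blk mem_B)
open B4Sect5Proof (latticeConst latticeConst_nonneg)
open B5Hk103ScalarZd (kerH cH deltaH deltaH_pos cH_pos summable_expX tsum_expX_le tsum_blocks summable_blocks
  kerH_blockRMS_le)
open B5Hk103Minimizer (energy HB)
open B5Ineq167SharpUpperZd (gamma1Sharp)
open B5Ineq167L2Zd (actionFormZd ineq167_scalar_l2)
open B5Hk165L2Zd (schur_row_summable schur_tsum HBZd summable_HBZd_row summable_HBZd_sq HBZd_eq_HB
  energy_HBZd_eq)

noncomputable section

variable {d : ℕ}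

/-! ## §1  Minkowski's inequality for a series of vectors on a finite window [folklore] -/

/-- Finite Cauchy–Schwarz in square-root form: `Σ_{p∈S} u(p)v(p) ≤ ‖u‖_{ℓ²(S)}‖v‖_{ℓ²(S)}`. [folklore] -/
theorem sum_mul_le_sqrt_mul_sqrt {α : Type*} (S : Finset α) (u v : α → ℝ) :
    ∑ p ∈ S, u p * v p ≤ Real.sqrt (∑ p ∈ S, u p ^ 2) * Real.sqrt (∑ p ∈ S, v p ^ 2) := by
  rw [← Real.sqrt_mul (Finset.sum_nonneg fun p _ => sq_nonneg (u p))]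
  exact (le_abs_self _).trans (Real.abs_le_sqrt (Finset.sum_mul_sq_le_sq_mul_sq S u v))

/-- **Minkowski's inequality for a series of vectors on a finite window** (duality form of the triangle
inequality in `ℓ²(S)`): if `y ↦ g_y(p)` is summable for every `p ∈ S` and `Σ'_y ‖g_y‖_{ℓ²(S)} < ∞`, then
`Σ_{p∈S} (Σ'_y g_y(p))² ≤ (Σ'_y ‖g_y‖_{ℓ²(S)})²`. [folklore] -/
theorem sum_sq_tsum_le {α β : Type*} (S : Finset α) {g : β → α → ℝ}
    (hrow : ∀ p ∈ S, Summable fun y => g y p)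
    (hnorm : Summable fun y => Real.sqrt (∑ p ∈ S, g y p ^ 2)) :
    ∑ p ∈ S, (∑' y, g y p) ^ 2 ≤ (∑' y, Real.sqrt (∑ p ∈ S, g y p ^ 2)) ^ 2 := by
  obtain ⟨G, hG⟩ : ∃ G : α → ℝ, G = fun p => ∑' y, g y p := ⟨_, rfl⟩
  obtain ⟨ny, hny⟩ : ∃ ny : β → ℝ, ny = fun y => Real.sqrt (∑ p ∈ S, g y p ^ 2) := ⟨_, rfl⟩
  have eG : ∀ p, ∑' y, g y p = G p := fun p => by rw [hG]
  have eny : ∀ y, Real.sqrt (∑ p ∈ S, g y p ^ 2) = ny y := fun y => by rw [hny]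
  simp_rw [eG, eny]
  obtain ⟨NG, hNG⟩ : ∃ NG : ℝ, NG = Real.sqrt (∑ p ∈ S, G p ^ 2) := ⟨_, rfl⟩
  have hNG0 : 0 ≤ NG := by rw [hNG]; exact Real.sqrt_nonneg _
  have hL0 : 0 ≤ ∑' y, ny y := tsum_nonneg fun y => by rw [← eny]; exact Real.sqrt_nonneg _
  have hrowG : ∀ p ∈ S, Summable fun y => G p * g y p := fun p hp => (hrow p hp).mul_left (G p)
  -- `‖G‖² = Σ'_y ⟨G, g_y⟩_S`
  have h1 : ∑ p ∈ S, G p ^ 2 = ∑' y, ∑ p ∈ S, G p * g y p := by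
    rw [Summable.tsum_finsetSum hrowG]
    refine Finset.sum_congr rfl fun p _ => ?_
    rw [tsum_mul_left, eG p, sq]
  -- `⟨G, g_y⟩_S ≤ ‖G‖_S‖g_y‖_S`
  have hpt : ∀ y, ∑ p ∈ S, G p * g y p ≤ NG * ny y := fun y => by
    rw [← eny, hNG]; exact sum_mul_le_sqrt_mul_sqrt S G (g y)
  have hSl : Summable fun y => ∑ p ∈ S, G p * g y p := summable_sum hrowG
  have h2 : ∑ p ∈ S, G p ^ 2 ≤ NG * ∑' y, ny y := by
    rw [h1]
    calc ∑' y, ∑ p ∈ S, G p * g y p ≤ ∑' y, NG * ny y :=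
          Summable.tsum_le_tsum hpt hSl ((hnorm.congr fun y => eny y).mul_left NG)
      _ = NG * ∑' y, ny y := tsum_mul_left
  have h3 : NG ^ 2 = ∑ p ∈ S, G p ^ 2 := by
    rw [hNG]; exact Real.sq_sqrt (Finset.sum_nonneg fun p _ => sq_nonneg _)
  rw [← h3] at h2 ⊢
  nlinarith [sq_nonneg (∑' y, ny y - NG), h2, hNG0, hL0]

/-! ## §2  Block norms of the kernel: `‖H(·,y)‖_{ℓ²(B(y″))} ≤ c_H (n+1)^{d/2} e^{−δ_H|y″−y|_∞}` [folklore] -/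

/-- The `ℓ²` norm of the column `H(·,y)` over the block `B(y″)`. [folklore] -/
def blockNorm (n : ℕ) (a : ℝ) (y'' y : X d) : ℝ := Real.sqrt (∑ p ∈ B n y'', kerH n a p y ^ 2)

/-- Block norms are non-negative. [folklore] -/
theorem blockNorm_nonneg (n : ℕ) (a : ℝ) (y'' y : X d) : 0 ≤ blockNorm n a y'' y := Real.sqrt_nonneg _

/-- **Block norms decay**: `‖H(·,y)‖_{ℓ²(B(y″))} ≤ c_H (n+1)^{d/2} e^{−δ_H|y″−y|_∞}` — the tree's mesh-free block-RMS
decay `kerH_blockRMS_le` (a property of the scalar `GQ'*(Q'G'Q'*)⁻¹` of (1.103), p. 34), un-normalised. [folklore] -/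
theorem blockNorm_le (n : ℕ) {a : ℝ} (ha : 0 < a) (y'' y : X d) :
    blockNorm n a y'' y
      ≤ cH d a * Real.sqrt (((n : ℝ) + 1) ^ d) * Real.exp (-(deltaH d a * dist y'' y)) := by
  have hN : (0 : ℝ) < ((n : ℝ) + 1) ^ d := by positivity
  have hsN : 0 < Real.sqrt (((n : ℝ) + 1) ^ d) := Real.sqrt_pos.2 hN
  have h := kerH_blockRMS_le n ha y'' y
  rw [Real.sqrt_mul (inv_nonneg.2 hN.le), Real.sqrt_inv, inv_mul_le_iff₀ hsN] at h
  calc blockNorm n a y'' y = Real.sqrt (∑ p ∈ B n y'', kerH n a p y ^ 2) := rfl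
    _ ≤ Real.sqrt (((n : ℝ) + 1) ^ d) * (cH d a * Real.exp (-(deltaH d a * dist y'' y))) := h
    _ = cH d a * Real.sqrt (((n : ℝ) + 1) ^ d) * Real.exp (-(deltaH d a * dist y'' y)) := by ring

/-- Rows of the block-norm kernel are summable. [folklore] -/
theorem summable_blockNorm_row (n : ℕ) {a : ℝ} (ha : 0 < a) (y'' : X d) :
    Summable fun y : X d => blockNorm n a y'' y :=
  Summable.of_nonneg_of_le (fun y => blockNorm_nonneg n a y'' y) (fun y => blockNorm_le n ha y'' y)
    ((summable_expX (deltaH_pos d ha) y'').mul_left _)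

/-- Columns of the block-norm kernel are summable. [folklore] -/
theorem summable_blockNorm_col (n : ℕ) {a : ℝ} (ha : 0 < a) (y : X d) :
    Summable fun y'' : X d => blockNorm n a y'' y := by
  refine Summable.of_nonneg_of_le (fun y'' => blockNorm_nonneg n a y'' y) (fun y'' => ?_)
    ((summable_expX (deltaH_pos d ha) y).mul_left (cH d a * Real.sqrt (((n : ℝ) + 1) ^ d)))
  rw [dist_comm]; exact blockNorm_le n ha y'' y

/-- Row sums: `Σ'_y ‖H(·,y)‖_{ℓ²(B(y″))} ≤ c_H (n+1)^{d/2} K_d(δ_H)`. [folklore] -/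
theorem tsum_blockNorm_row_le (n : ℕ) {a : ℝ} (ha : 0 < a) (y'' : X d) :
    ∑' y : X d, blockNorm n a y'' y ≤ cH d a * Real.sqrt (((n : ℝ) + 1) ^ d) * latticeConst d (deltaH d a) := by
  have hc : 0 ≤ cH d a * Real.sqrt (((n : ℝ) + 1) ^ d) := mul_nonneg (cH_pos d ha).le (Real.sqrt_nonneg _)
  calc ∑' y : X d, blockNorm n a y'' y
        ≤ ∑' y : X d, cH d a * Real.sqrt (((n : ℝ) + 1) ^ d) * Real.exp (-(deltaH d a * dist y'' y)) :=
          Summable.tsum_le_tsum (fun y => blockNorm_le n ha y'' y) (summable_blockNorm_row n ha y'')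
            ((summable_expX (deltaH_pos d ha) y'').mul_left _)
    _ = cH d a * Real.sqrt (((n : ℝ) + 1) ^ d) * ∑' y : X d, Real.exp (-(deltaH d a * dist y'' y)) :=
          tsum_mul_left
    _ ≤ cH d a * Real.sqrt (((n : ℝ) + 1) ^ d) * latticeConst d (deltaH d a) :=
          mul_le_mul_of_nonneg_left (tsum_expX_le (deltaH_pos d ha) y'') hc

/-- Column sums: `Σ'_{y″} ‖H(·,y)‖_{ℓ²(B(y″))} ≤ c_H (n+1)^{d/2} K_d(δ_H)`. [folklore] -/
theorem tsum_blockNorm_col_le (n : ℕ) {a : ℝ} (ha : 0 < a) (y : X d) :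
    ∑' y'' : X d, blockNorm n a y'' y ≤ cH d a * Real.sqrt (((n : ℝ) + 1) ^ d) * latticeConst d (deltaH d a) := by
  have hc : 0 ≤ cH d a * Real.sqrt (((n : ℝ) + 1) ^ d) := mul_nonneg (cH_pos d ha).le (Real.sqrt_nonneg _)
  have hle : ∀ y'' : X d,
      blockNorm n a y'' y ≤ cH d a * Real.sqrt (((n : ℝ) + 1) ^ d) * Real.exp (-(deltaH d a * dist y y'')) :=
    fun y'' => by rw [dist_comm]; exact blockNorm_le n ha y'' y
  calc ∑' y'' : X d, blockNorm n a y'' y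
        ≤ ∑' y'' : X d, cH d a * Real.sqrt (((n : ℝ) + 1) ^ d) * Real.exp (-(deltaH d a * dist y y'')) :=
          Summable.tsum_le_tsum hle (summable_blockNorm_col n ha y) ((summable_expX (deltaH_pos d ha) y).mul_left _)
    _ = cH d a * Real.sqrt (((n : ℝ) + 1) ^ d) * ∑' y'' : X d, Real.exp (-(deltaH d a * dist y y'')) :=
          tsum_mul_left
    _ ≤ cH d a * Real.sqrt (((n : ℝ) + 1) ^ d) * latticeConst d (deltaH d a) :=
          mul_le_mul_of_nonneg_left (tsum_expX_le (deltaH_pos d ha) y) hc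

/-! ## §3  The block estimate `Σ_{p∈B(y″)} (H B)(p)² ≤ (Σ'_y ‖H(·,y)‖_{ℓ²(B(y″))}|B(y)|)²` [folklore] -/

/-- `‖B(y)H(·,y)‖_{ℓ²(B(y″))} = ‖H(·,y)‖_{ℓ²(B(y″))}·|B(y)|`. [folklore] -/
theorem sqrt_sum_sq_mul_kerH (n : ℕ) (a : ℝ) (Bf : X d → ℝ) (y'' y : X d) :
    Real.sqrt (∑ p ∈ B n y'', (Bf y * kerH n a p y) ^ 2) = blockNorm n a y'' y * |Bf y| := by
  simp_rw [mul_pow]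
  rw [← Finset.mul_sum, Real.sqrt_mul (sq_nonneg _), Real.sqrt_sq_eq_abs]
  unfold blockNorm
  ring

/-- `y ↦ ‖H(·,y)‖_{ℓ²(B(y″))}|B(y)|` is summable for `B ∈ ℓ²(ℤ^d)`. [folklore] -/
theorem summable_blockNorm_mul_abs (n : ℕ) {a : ℝ} (ha : 0 < a) {Bf : X d → ℝ}
    (hB : Summable fun x => Bf x ^ 2) (y'' : X d) :
    Summable fun y : X d => blockNorm n a y'' y * |Bf y| :=
  (schur_row_summable (M := blockNorm n a) (fun y'' y => blockNorm_nonneg n a y'' y)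
    (fun y'' => summable_blockNorm_row n ha y'') hB y'').2

/-- **Block estimate**: `Σ_{p∈B(y″)} (H B)(p)² ≤ (Σ'_y ‖H(·,y)‖_{ℓ²(B(y″))}|B(y)|)²` for `B ∈ ℓ²(ℤ^d)` (Minkowski on
the window `B(y″)` for the series `H B = Σ_y B(y)H(·,y)`). [folklore] -/
theorem sum_block_HBZd_sq_le (n : ℕ) {a : ℝ} (ha : 0 < a) {Bf : X d → ℝ} (hB : Summable fun x => Bf x ^ 2)
    (y'' : X d) :
    ∑ p ∈ B n y'', HBZd n a Bf p ^ 2 ≤ (∑' y : X d, blockNorm n a y'' y * |Bf y|) ^ 2 := by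
  have hn' : Summable fun y : X d => Real.sqrt (∑ p ∈ B n y'', (Bf y * kerH n a p y) ^ 2) := by
    simp_rw [sqrt_sum_sq_mul_kerH]; exact summable_blockNorm_mul_abs n ha hB y''
  have h := sum_sq_tsum_le (B n y'') (g := fun y p => Bf y * kerH n a p y)
    (fun p _ => summable_HBZd_row n ha hB p) hn'
  simp_rw [sqrt_sum_sq_mul_kerH] at h
  simpa only [HBZd] using h

/-! ## §4  The mesh-uniform bound `‖H B‖²_η ≤ (c_H K_d(δ_H))² ‖B‖²_{ℓ²(ℤ^d)}` [cite p.29 / (1.103) p.34] -/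

/-- **`H_k : ℓ²(ℤ^d) → ℓ²` with the sharp mesh dependence**: `Σ'_p (H B)(p)² ≤ (n+1)^d (c_H K_d(δ_H))² Σ'_y B(y)²`
for every square-summable coarse field `B` (block estimate + the `tsum` Schur test for the block-norm kernel +
summation block by block). [cite: Balaban1984PropagatorsI, p.29] -/
theorem tsum_HBZd_sq_le (n : ℕ) {a : ℝ} (ha : 0 < a) (Bf : X d → ℝ) (hB : Summable fun x => Bf x ^ 2) :
    ∑' p : X d, HBZd n a Bf p ^ 2
      ≤ ((n : ℝ) + 1) ^ d * (cH d a * latticeConst d (deltaH d a)) ^ 2 * ∑' y : X d, Bf y ^ 2 := by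
  have hN : (0 : ℝ) ≤ ((n : ℝ) + 1) ^ d := by positivity
  set R : ℝ := cH d a * Real.sqrt (((n : ℝ) + 1) ^ d) * latticeConst d (deltaH d a) with hR
  have hR0 : 0 ≤ R :=
    mul_nonneg (mul_nonneg (cH_pos d ha).le (Real.sqrt_nonneg _)) (latticeConst_nonneg d (deltaH_pos d ha).le)
  have hS := schur_tsum (M := blockNorm n a) (fun y'' y => blockNorm_nonneg n a y'' y) hR0
    (fun y'' => summable_blockNorm_row n ha y'') (fun y'' => tsum_blockNorm_row_le n ha y'')
    (fun y => summable_blockNorm_col n ha y) (fun y => tsum_blockNorm_col_le n ha y) hB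
  have hsq : Real.sqrt (((n : ℝ) + 1) ^ d) * Real.sqrt (((n : ℝ) + 1) ^ d) = ((n : ℝ) + 1) ^ d :=
    Real.mul_self_sqrt hN
  calc ∑' p : X d, HBZd n a Bf p ^ 2 = ∑' y'' : X d, ∑ p ∈ B n y'', HBZd n a Bf p ^ 2 :=
        (tsum_blocks n (summable_HBZd_sq n ha hB)).symm
    _ ≤ ∑' y'' : X d, (∑' y : X d, blockNorm n a y'' y * |Bf y|) ^ 2 :=
        Summable.tsum_le_tsum (fun y'' => sum_block_HBZd_sq_le n ha hB y'')
          (summable_blocks n (summable_HBZd_sq n ha hB)) hS.1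
    _ ≤ R * R * ∑' y : X d, Bf y ^ 2 := hS.2
    _ = (cH d a * latticeConst d (deltaH d a)) ^ 2
          * (Real.sqrt (((n : ℝ) + 1) ^ d) * Real.sqrt (((n : ℝ) + 1) ^ d)) * ∑' y : X d, Bf y ^ 2 := by
        rw [hR]; ring
    _ = ((n : ℝ) + 1) ^ d * (cH d a * latticeConst d (deltaH d a)) ^ 2 * ∑' y : X d, Bf y ^ 2 := by
        rw [hsq]; ring

/-- **`H_k` is bounded `ℓ²(ℤ^d) → ℓ²_η` UNIFORMLY IN THE MESH**: in the `η`-weighted norm of the fine lattice,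
`(n+1)^{−d} Σ'_p (H B)(p)² ≤ (c_H(d,a) K_d(δ_H(d,a)))² Σ'_y B(y)²` for every `n`, every `a > 0` and every
square-summable `B` — the constant depends on `d, a` only. [cite: Balaban1984PropagatorsI, p.29] -/
theorem tsum_HBZd_sq_le_uniform (n : ℕ) {a : ℝ} (ha : 0 < a) (Bf : X d → ℝ)
    (hB : Summable fun x => Bf x ^ 2) :
    (((n : ℝ) + 1) ^ d)⁻¹ * ∑' p : X d, HBZd n a Bf p ^ 2
      ≤ (cH d a * latticeConst d (deltaH d a)) ^ 2 * ∑' y : X d, Bf y ^ 2 := by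
  have hN : (0 : ℝ) < ((n : ℝ) + 1) ^ d := by positivity
  rw [inv_mul_le_iff₀ hN, ← mul_assoc]
  exact tsum_HBZd_sq_le n ha Bf hB

/-- **Printed shape**: there is a constant `C > 0` depending on `d, a` only with `‖H_kB‖²_η ≤ C‖B‖²_{ℓ²(ℤ^d)}` for
every mesh `n` and every square-summable `B` (witness `C = (c_H K_d(δ_H))²`; if the kernel constants vanish the
witness `1` serves). [cite: Balaban1984PropagatorsI, p.29] -/
theorem HBZd_uniform_exists (d : ℕ) {a : ℝ} (ha : 0 < a) :
    ∃ C : ℝ, 0 < C ∧ ∀ (n : ℕ) (Bf : X d → ℝ), (Summable fun x => Bf x ^ 2) →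
      (((n : ℝ) + 1) ^ d)⁻¹ * ∑' p : X d, HBZd n a Bf p ^ 2 ≤ C * ∑' y : X d, Bf y ^ 2 := by
  refine ⟨(cH d a * latticeConst d (deltaH d a)) ^ 2 + 1, by positivity, fun n Bf hB => ?_⟩
  have h := tsum_HBZd_sq_le_uniform n ha Bf hB
  have h0 : 0 ≤ ∑' y : X d, Bf y ^ 2 := tsum_nonneg fun y => sq_nonneg _
  nlinarith

/-! ## §5  Corollaries: finitely supported data; the `η`-normalised energy identity [cite (1.65) p.29] -/

/-- The same mesh-uniform bound for the tree's finitely supported `HB n a T B` (`B` vanishing off `T`).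
[cite: Balaban1984PropagatorsI, p.29] -/
theorem tsum_HB_sq_le_uniform (n : ℕ) {a : ℝ} (ha : 0 < a) (T : Finset (X d)) (Bf : X d → ℝ)
    (hT : ∀ y ∉ T, Bf y = 0) :
    (((n : ℝ) + 1) ^ d)⁻¹ * ∑' p : X d, HB n a T Bf p ^ 2
      ≤ (cH d a * latticeConst d (deltaH d a)) ^ 2 * ∑ y ∈ T, Bf y ^ 2 := by
  have hB : Summable fun x => Bf x ^ 2 := by
    refine summable_of_ne_finset_zero (s := T) fun y hy => ?_
    rw [hT y hy]; exact zero_pow two_ne_zero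
  have hsum : ∑' y : X d, Bf y ^ 2 = ∑ y ∈ T, Bf y ^ 2 :=
    tsum_eq_sum fun y hy => by rw [hT y hy]; exact zero_pow two_ne_zero
  rw [← HBZd_eq_HB n a T Bf hT, ← hsum]
  exact tsum_HBZd_sq_le_uniform n ha Bf hB

/-- **(1.65) in `η`-units, with (1.67)**: `η^{d−2}⟨∂(H B), ∂(H B)⟩ = ⟨B, Δ^{scalar}_{n,a}B⟩_{ℤ^d} ≤ (π²/4)^{d+1}⟨∂₁B, ∂₁B⟩`
for every square-summable `B` — the Dirichlet energy of `H_kB` in the `η`-lattice normalisation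
(`η^d Σ_{bonds} (η⁻¹∇)² = η^{d−2} Σ_{bonds} ∇²`, `η = (n+1)⁻¹`) is bounded by a mesh-independent multiple of the
unit-lattice energy of `B`. [cite: Balaban1984PropagatorsI, (1.65) p.29] -/
theorem energy_HBZd_eta (n : ℕ) {a : ℝ} (ha : 0 < a) (Bf : X d → ℝ) (hB : Summable fun x => Bf x ^ 2) :
    ((n : ℝ) + 1) ^ 2 / ((n : ℝ) + 1) ^ d * energy (HBZd n a Bf) = actionFormZd n a Bf ∧
      ((n : ℝ) + 1) ^ 2 / ((n : ℝ) + 1) ^ d * energy (HBZd n a Bf) ≤ gamma1Sharp d * energy Bf := by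
  have hN : (0 : ℝ) < ((n : ℝ) + 1) ^ d := by positivity
  have h2 : (0 : ℝ) < ((n : ℝ) + 1) ^ 2 := by positivity
  have hE : ((n : ℝ) + 1) ^ 2 / ((n : ℝ) + 1) ^ d * energy (HBZd n a Bf) = actionFormZd n a Bf := by
    rw [energy_HBZd_eq n ha Bf hB]
    field_simp
  exact ⟨hE, hE ▸ (ineq167_scalar_l2 n ha Bf hB).2⟩

end

end Literature.MathematicalPhysics.QuantumFieldTheory.Balaban1983to89.B5HkUniformL2Zd
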